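import Summits.Ventures.PercRepro.C025ProfileFourReduce
import Summits.Ventures.PercRepro.C025ProfileGen

/-!
# THE ROW `(3,4)` OF THE PROFILE INEQUALITY — the rule-free reduction to simple matroids of rank `≥ 5` (night-3 g12)
`proofs/NIGHT3-G12-STAGED.md` §4. Independent of any certificate rule: `(Π_{3,4})` holds on EVERY finite matroid as soon as it
holds on every SIMPLE matroid of rank `≥ 5` — rank `≤ 3` is the empty level (`profileIneq_of_eRank_lt`), rank `4` the top level
(`Profile.profileIneq_top`), and a non-simple matroid reduces to its simplification by the row reduction `profileIneq_row_of_simple`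
with the row `(2,3)` (`profileIneq_two_three`). The certificate form: a family `W` (depending on the matroid) that is a local
certificate (`(Cap)`, `(Dem)` of `profileIneq_of_cert`) on every simple matroid of rank `≥ 5` proves the row everywhere.
The staged rule of `C025ProfileStagedRule` is NOT such a certificate (its rigid bound fails on an `11`-point rank-`5` matroid with a
`7`-point line, NIGHT3-G12-STAGED.md §6); these reductions do not depend on it.
-/
open scoped Matroid
namespace PercRepro
open Set Finset ThmH
section ThreeFourReduce
variable {α : Type} [DecidableEq α]

/-- `(Π_{3,4})` on a matroid, given it in rank `≥ 5` (the lower ranks are the empty and top levels). -/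
theorem profileIneq_three_four_of_five (N : Matroid α) [N.Finite]
    (h5 : (5 : ℕ∞) ≤ N.eRank → Profile.ProfileIneq N 3 4) : Profile.ProfileIneq N 3 4 := by
  have hRtop : N.eRank ≠ ⊤ := N.eRank_ne_top_iff.2 inferInstance
  obtain ⟨R, hRe⟩ := ENat.ne_top_iff_exists.1 hRtop
  rcases Nat.lt_or_ge R 4 with hlt4 | hge4
  · apply profileIneq_of_eRank_lt
    rw [← hRe]; exact_mod_cast hlt4
  rcases Nat.lt_or_ge R 5 with hlt5 | hge5
  · have heq4 : R = 4 := by omega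
    exact Profile.profileIneq_top (R := 4) (by rw [← hRe, heq4]) 3
  · exact h5 (by rw [← hRe]; exact_mod_cast hge5)

/-- **THE ROW `(3,4)` FOR EVERY FINITE MATROID REDUCES TO SIMPLE MATROIDS OF RANK `≥ 5`.** -/
theorem profileIneq_three_four_of_simple_five
    (h : ∀ (N : Matroid α) [N.Finite], (∀ T ⊆ N.E, T.encard ≤ 2 → N.Indep T) → (5 : ℕ∞) ≤ N.eRank →
      Profile.ProfileIneq N 3 4)
    (M : Matroid α) [M.Finite] : Profile.ProfileIneq M 3 4 :=
  profileIneq_row_of_simple (q := 2) (u := 3) (by omega)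
    (fun N _ hs => profileIneq_three_four_of_five N (h N hs))
    (fun N _ => profileIneq_two_three N) M

/-- The certificate form: a family `W` (depending on the matroid) that is a local certificate — `(Cap)`: every rank-`4` set
receives at most `1`; `(Dem)`: every rank-`3` set `B` receives at least its price — on every simple matroid of rank `≥ 5` proves
the row `(3,4)` on every finite matroid. -/
theorem profileIneq_three_four_of_cert_on_simple
    (W : Matroid α → Finset α → Finset α → ℚ)
    (hCap : ∀ (N : Matroid α) [N.Finite], (∀ T ⊆ N.E, T.encard ≤ 2 → N.Indep T) → (5 : ℕ∞) ≤ N.eRank →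
      ∀ S ∈ Shadow.levelSet N 4, ∑ B ∈ (Profile.Rq N 3).filter (· ⊆ S), W N B S ≤ 1)
    (hDem : ∀ (N : Matroid α) [N.Finite], (∀ T ⊆ N.E, T.encard ≤ 2 → N.Indep T) → (5 : ℕ∞) ≤ N.eRank →
      ∀ B ∈ Profile.Rq N 3, Profile.price N 3 4 B ≤ ∑ S ∈ (Shadow.levelSet N 4).filter (B ⊆ ·), W N B S)
    (M : Matroid α) [M.Finite] : Profile.ProfileIneq M 3 4 :=
  profileIneq_three_four_of_simple_five
    (fun N _ hs hR => profileIneq_of_cert (M := N) 3 4 (W N) (hCap N hs hR) (hDem N hs hR)) M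

end ThreeFourReduce
end PercRepro
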